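import Mathlib
import Summits.KontsevichZagierPeriods.Zeta5Search.Certificates.RayC1Forms
import Summits.KontsevichZagierPeriods.Zeta5Search.Certificates.RecordRayAperyPQ
import Summits.KontsevichZagierPeriods.Zeta5Search.Certificates.RecordRayConnection
import HarnessLib

/-!
# S4-C1 clause (E), the ray-specific half: the unit `ρ(a·n)` of the C1 ray in factorials and its ratio (cert-1 g7; STAGED prep)

HONEST FRAMING: systematic search; no irrationality claim unless certified.  C1 is the cell's CALIBRATION ray
`a = (18,32,23,30,28,38,43,30)` (`RayC1Forms`: `aC1`, `bC1 = n·(85; 35,32,30,27,25,22,20)`, `d = 64n`); clause (M) only is in the tree for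
it; `λ* = 108.2193` is its certified tie; every `γ < 1`.  This file is pure factorial bookkeeping about the explicit rational
`ρ(a·n) = rhoOf (aC1 n)` — nothing about the size of anything or about `ζ(5)` — and is the C1 twin of §§1–2 of S4-R1 #9
`Certificates/RecordRayAperyPQ` (whose generic helpers `linVal`, `linFac`, `factorial_mul_succ`, `linVal_pos` it reuses):

* `rhoOf_aC1_eq` : `ρ(a·n) = (−1)^n · F(n)/G(n)` with `F(n) = ∏_{(j,k)∈E} ((85−β_j−β_k)n)!` (multipliers 18,20,23,25,23,26,28,31,28,33,35,38,38,40,43)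
  and `G(n) = 4·(35n)!(27n)!(25n)!(22n)!(20n)!·(64n)!` — NOTE THE SIGN `(−1)^{Σ b_j} = (−1)^{191n} = (−1)^n` (on the record ray it is `+1`);
* `rho_succ_C1` : `ρ(a·(n+1))·D(n) = −ρ(a·n)·N(n)` with `N`, `D` explicit products of linear factors, positive at every `n`
  (`NvalC1_pos`, `DvalC1_pos`), and their polynomial versions `NpolyC1`, `DpolyC1` (`…_eval`) — `ρ ≠ 0` itself is the tree's
  `RayC1KernelBase.rhoOf_aC1_ne_zero`;
* the dictionary to the coefficient frame of `RecordRayConnection` (rows `b, b+e₇, b+2e₇`, columns `U, W, V`):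
  `bC1'_eq_bump`, `c1Q_eq_adjugate` (`Q_n = ρ_n·adj T(b_n)₂₂`, `n ≥ 1`), `c1P_eq_adjugate` (`P_n = −ρ_n·adj T(b_n)₀₂`),
  `c1Form_eq_realAdjugate` (`L_n = −ρ_n·adj T_ℝ(b_n)₀₂`) — the C1 copies of `recordQ/P/Form_eq_adjugate`.

With fam-tele's C1 chain (K3 for the C1 frame) the Cramer eliminant of S4-R1 #7 then gives `IsAperyType` for `(P̂, Q̂) = (c1P, c1Q)/ρ`, and
this file transports it to the literal pair exactly as #9 does, with the factor `(−1)^k` on the k-th coefficient.  Not filed before the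
lead's S4-C1 GO (ruling 06:00Z: GO/NO-GO after R8 (vi)).
-/

namespace Summit.KontsevichZagierPeriods.Zeta5Search.RayC1

open Finset Polynomial
open Summit.KontsevichZagierPeriods.Zeta5Search.WedgeDictionary (rhoOf dOf Epairs)
open Summit.KontsevichZagierPeriods.Zeta5Search.RecordRay.Generic (linVal linFac linFac_eval linVal_pos factorial_mul_succ)
open Literature.NumberTheory.Irrationality.BrownZudilin2022 (bOfA)

/-! ### 1. `ρ(a·n)` in factorials -/

/-- The numerator of `ρ(a·n)` on C1: `∏_{(j,k)∈E} ((85 − β_j − β_k)·n)!`, pairs in the tree's order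
`12,13,14,15,23,24,25,26,34,36,37,47,56,57,67`. -/
def FnumC1 (n : ℕ) : ℚ :=
  (((18 * n).factorial : ℕ) : ℚ) * (((20 * n).factorial : ℕ) : ℚ) * (((23 * n).factorial : ℕ) : ℚ) *
    (((25 * n).factorial : ℕ) : ℚ) * (((23 * n).factorial : ℕ) : ℚ) * (((26 * n).factorial : ℕ) : ℚ) *
    (((28 * n).factorial : ℕ) : ℚ) * (((31 * n).factorial : ℕ) : ℚ) * (((28 * n).factorial : ℕ) : ℚ) *
    (((33 * n).factorial : ℕ) : ℚ) * (((35 * n).factorial : ℕ) : ℚ) * (((38 * n).factorial : ℕ) : ℚ) *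
    (((38 * n).factorial : ℕ) : ℚ) * (((40 * n).factorial : ℕ) : ℚ) * (((43 * n).factorial : ℕ) : ℚ)

/-- The denominator of `ρ(a·n)` on C1: `4 · (35n)! (27n)! (25n)! (22n)! (20n)! · (64n)!`. -/
def GdenC1 (n : ℕ) : ℚ :=
  4 * ((((35 * n).factorial : ℕ) : ℚ) * (((27 * n).factorial : ℕ) : ℚ) * (((25 * n).factorial : ℕ) : ℚ) *
    (((22 * n).factorial : ℕ) : ℚ) * (((20 * n).factorial : ℕ) : ℚ)) * (((64 * n).factorial : ℕ) : ℚ)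

/-- The denominator is positive. -/
theorem GdenC1_pos (n : ℕ) : 0 < GdenC1 n := by unfold GdenC1; positivity

/-- **`ρ(a·n)` on C1 in factorials, with its sign `(−1)^n`.** -/
theorem rhoOf_aC1_eq (n : ℕ) : rhoOf (aC1 n) = (-1) ^ n * FnumC1 n / GdenC1 n := by
  unfold FnumC1 GdenC1
  have hb0 : bOfA (aC1 n) 0 = 85 * n := by rw [bOfA_aC1, bC1_zero]
  have hbj : ∀ j : ℕ, j ∈ range 7 → bOfA (aC1 n) (j + 1) = ((βC1 j * n : ℕ) : ℤ) := fun j hj => by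
    rw [bOfA_aC1, bC1_succ n hj]
  have h1 := hbj 0 (by simp)
  have h2 := hbj 1 (by simp)
  have h3 := hbj 2 (by simp)
  have h4 := hbj 3 (by simp)
  have h5 := hbj 4 (by simp)
  have h6 := hbj 5 (by simp)
  have h7 := hbj 6 (by simp)
  simp only [βC1] at h1 h2 h3 h4 h5 h6 h7
  norm_num at h1 h2 h3 h4 h5 h6 h7
  have hd := dOf_aC1 n
  have hs : (∑ j ∈ range 7, bOfA (aC1 n) (j + 1)).toNat = 191 * n := by
    simp only [sum_range_succ, sum_range_zero, zero_add, Nat.reduceAdd, h1, h2, h3, h4, h5, h6, h7]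
    rw [show (35 : ℤ) * n + 32 * n + 30 * n + 27 * n + 25 * n + 22 * n + 20 * n = ((191 * n : ℕ) : ℤ) by
      push_cast; ring, Int.toNat_natCast]
  have hsign : ((-1 : ℚ)) ^ (191 * n) = (-1) ^ n := by
    rw [pow_mul]; norm_num
  unfold rhoOf
  simp only [Epairs, List.map_cons, List.map_nil, List.prod_cons, List.prod_nil, hs, hsign, hb0, h1, h2, h3, h4, h5, h6,
    h7, hd]
  rw [show (85 : ℤ) * n - 35 * n - 32 * n = ((18 * n : ℕ) : ℤ) by push_cast; ring,
    show (85 : ℤ) * n - 35 * n - 30 * n = ((20 * n : ℕ) : ℤ) by push_cast; ring,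
    show (85 : ℤ) * n - 35 * n - 27 * n = ((23 * n : ℕ) : ℤ) by push_cast; ring,
    show (85 : ℤ) * n - 35 * n - 25 * n = ((25 * n : ℕ) : ℤ) by push_cast; ring,
    show (85 : ℤ) * n - 32 * n - 30 * n = ((23 * n : ℕ) : ℤ) by push_cast; ring,
    show (85 : ℤ) * n - 32 * n - 27 * n = ((26 * n : ℕ) : ℤ) by push_cast; ring,
    show (85 : ℤ) * n - 32 * n - 25 * n = ((28 * n : ℕ) : ℤ) by push_cast; ring,
    show (85 : ℤ) * n - 32 * n - 22 * n = ((31 * n : ℕ) : ℤ) by push_cast; ring,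
    show (85 : ℤ) * n - 30 * n - 27 * n = ((28 * n : ℕ) : ℤ) by push_cast; ring,
    show (85 : ℤ) * n - 30 * n - 22 * n = ((33 * n : ℕ) : ℤ) by push_cast; ring,
    show (85 : ℤ) * n - 30 * n - 20 * n = ((35 * n : ℕ) : ℤ) by push_cast; ring,
    show (85 : ℤ) * n - 27 * n - 20 * n = ((38 * n : ℕ) : ℤ) by push_cast; ring,
    show (85 : ℤ) * n - 25 * n - 22 * n = ((38 * n : ℕ) : ℤ) by push_cast; ring,
    show (85 : ℤ) * n - 25 * n - 20 * n = ((40 * n : ℕ) : ℤ) by push_cast; ring,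
    show (85 : ℤ) * n - 22 * n - 20 * n = ((43 * n : ℕ) : ℤ) by push_cast; ring]
  simp only [Int.toNat_natCast,
    show ((35 : ℤ) * n).toNat = 35 * n by rw [show (35 : ℤ) * n = ((35 * n : ℕ) : ℤ) by push_cast; ring, Int.toNat_natCast],
    show ((27 : ℤ) * n).toNat = 27 * n by rw [show (27 : ℤ) * n = ((27 * n : ℕ) : ℤ) by push_cast; ring, Int.toNat_natCast],
    show ((25 : ℤ) * n).toNat = 25 * n by rw [show (25 : ℤ) * n = ((25 * n : ℕ) : ℤ) by push_cast; ring, Int.toNat_natCast],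
    show ((22 : ℤ) * n).toNat = 22 * n by rw [show (22 : ℤ) * n = ((22 * n : ℕ) : ℤ) by push_cast; ring, Int.toNat_natCast],
    show ((20 : ℤ) * n).toNat = 20 * n by rw [show (20 : ℤ) * n = ((20 * n : ℕ) : ℤ) by push_cast; ring, Int.toNat_natCast],
    show ((64 : ℤ) * n).toNat = 64 * n by rw [show (64 : ℤ) * n = ((64 * n : ℕ) : ℤ) by push_cast; ring, Int.toNat_natCast]]
  ring

/-- The numerator is positive. -/
theorem FnumC1_pos (n : ℕ) : 0 < FnumC1 n := by unfold FnumC1; positivity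

/-! ### 2. The ratio `ρ_{n+1}/ρ_n = −N(n)/D(n)` -/

/-- `N(x)` for C1: the numerator ratio (fifteen pair factorials). -/
def NvalC1 (x : ℚ) : ℚ :=
  linVal 18 x * linVal 20 x * linVal 23 x * linVal 25 x * linVal 23 x * linVal 26 x * linVal 28 x * linVal 31 x *
    linVal 28 x * linVal 33 x * linVal 35 x * linVal 38 x * linVal 38 x * linVal 40 x * linVal 43 x

/-- `D(x)` for C1: the denominator ratio (five single factorials and `d! = (64n)!`). -/
def DvalC1 (x : ℚ) : ℚ := linVal 35 x * linVal 27 x * linVal 25 x * linVal 22 x * linVal 20 x * linVal 64 x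

/-- `N` as a polynomial. -/
noncomputable def NpolyC1 : ℚ[X] :=
  linFac 18 * linFac 20 * linFac 23 * linFac 25 * linFac 23 * linFac 26 * linFac 28 * linFac 31 *
    linFac 28 * linFac 33 * linFac 35 * linFac 38 * linFac 38 * linFac 40 * linFac 43

/-- `D` as a polynomial. -/
noncomputable def DpolyC1 : ℚ[X] := linFac 35 * linFac 27 * linFac 25 * linFac 22 * linFac 20 * linFac 64

/-- `NpolyC1` evaluates to `NvalC1`. -/
theorem NpolyC1_eval (x : ℚ) : NpolyC1.eval x = NvalC1 x := by simp only [NpolyC1, NvalC1, eval_mul, linFac_eval]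
/-- `DpolyC1` evaluates to `DvalC1`. -/
theorem DpolyC1_eval (x : ℚ) : DpolyC1.eval x = DvalC1 x := by simp only [DpolyC1, DvalC1, eval_mul, linFac_eval]

/-- `D(n) > 0` on C1. -/
theorem DvalC1_pos (n : ℕ) : 0 < DvalC1 (n : ℚ) := by
  unfold DvalC1
  have h := linVal_pos
  exact mul_pos (mul_pos (mul_pos (mul_pos (mul_pos (h 35 n) (h 27 n)) (h 25 n)) (h 22 n)) (h 20 n)) (h 64 n)

/-- `N(n) > 0` on C1. -/
theorem NvalC1_pos (n : ℕ) : 0 < NvalC1 (n : ℚ) := by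
  unfold NvalC1
  have h := linVal_pos
  exact mul_pos (mul_pos (mul_pos (mul_pos (mul_pos (mul_pos (mul_pos (mul_pos (mul_pos (mul_pos (mul_pos (mul_pos
    (mul_pos (mul_pos (h 18 n) (h 20 n)) (h 23 n)) (h 25 n)) (h 23 n)) (h 26 n)) (h 28 n)) (h 31 n)) (h 28 n)) (h 33 n))
    (h 35 n)) (h 38 n)) (h 38 n)) (h 40 n)) (h 43 n)

/-- `F(n+1) = F(n) · N(n)` on C1. -/
theorem FnumC1_succ (n : ℕ) : FnumC1 (n + 1) = FnumC1 n * NvalC1 (n : ℚ) := by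
  unfold FnumC1 NvalC1
  simp only [factorial_mul_succ]
  ring

/-- `G(n+1) = G(n) · D(n)` on C1. -/
theorem GdenC1_succ (n : ℕ) : GdenC1 (n + 1) = GdenC1 n * DvalC1 (n : ℚ) := by
  unfold GdenC1 DvalC1
  simp only [factorial_mul_succ]
  ring

/-- **`ρ(a·(n+1))·D(n) = −ρ(a·n)·N(n)` on C1** (the sign flips at every step: `(−1)^{n+1} = −(−1)^n`). -/
theorem rho_succ_C1 (n : ℕ) : rhoOf (aC1 (n + 1)) * DvalC1 (n : ℚ) = -(rhoOf (aC1 n) * NvalC1 (n : ℚ)) := by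
  rw [rhoOf_aC1_eq, rhoOf_aC1_eq, FnumC1_succ, GdenC1_succ, pow_succ]
  have hG : GdenC1 n ≠ 0 := (GdenC1_pos n).ne'
  have hD : DvalC1 (n : ℚ) ≠ 0 := (DvalC1_pos n).ne'
  field_simp

/-- The shifts `D(X + j)` are nonzero polynomials (value at `0` is `D(j) > 0`). -/
theorem DpolyC1_comp_ne (j : ℕ) : DpolyC1.comp (X + C (j : ℚ)) ≠ 0 := by
  intro hp
  have h := congrArg (Polynomial.eval (0 : ℚ)) hp
  rw [eval_comp, eval_add, eval_X, eval_C, zero_add, DpolyC1_eval, eval_zero] at h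
  exact (DvalC1_pos j).ne' h

/-! ### 3. The C1 pair as adjugate entries of the coefficient frame -/

section Frame

open Summit.KontsevichZagierPeriods.Zeta5Search.RecordRay.Connection (frameMat realFrame)
open Summit.KontsevichZagierPeriods.Zeta5Search.WedgeDictionary (bump coeffU coeffW coeffV)

/-- `b′ = b + e₇` on C1, as a `bump`. -/
theorem bC1'_eq_bump (n : ℕ) : bC1' n = bump (bC1 n) 6 := by
  rw [bC1'_eq_update]; rfl

/-- `Q_n = ρ_n · adj(T(b_n))₂₂` on C1 (the `U ∧ W` minor on the rows `b_n, b_n + e₇`), `n ≥ 1`. -/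
theorem c1Q_eq_adjugate {n : ℕ} (hn : 1 ≤ n) :
    (c1Q n : ℚ) = rhoOf (aC1 n) * (frameMat (bC1 n)).adjugate 2 2 := by
  have h : (frameMat (bC1 n)).adjugate 2 2 =
      coeffU (bC1 n) * coeffW (bC1' n) - coeffU (bC1' n) * coeffW (bC1 n) := by
    rw [Matrix.adjugate_fin_three, bC1'_eq_bump]
    simp [frameMat]
    ring
  rw [h]
  exact c1Q_eq_wedge hn

/-- `P_n = −ρ_n · adj(T(b_n))₀₂` on C1 (the `W ∧ V` minor on the rows `b_n, b_n + e₇`), every `n`. -/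
theorem c1P_eq_adjugate (n : ℕ) : c1P n = -(rhoOf (aC1 n) * (frameMat (bC1 n)).adjugate 0 2) := by
  rw [c1P, Matrix.adjugate_fin_three, bC1'_eq_bump]
  simp [frameMat]
  ring

/-- `L_n = −ρ_n · adj(T_ℝ(b_n))₀₂` on C1 — definitional, no convergence needed. -/
theorem c1Form_eq_realAdjugate (n : ℕ) :
    c1Form n = -((rhoOf (aC1 n) : ℝ) * (realFrame (bC1 n)).adjugate 0 2) := by
  rw [c1Form, Matrix.adjugate_fin_three, bC1'_eq_bump]
  simp [realFrame]
  ring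

end Frame

end Summit.KontsevichZagierPeriods.Zeta5Search.RayC1
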